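import Summits.QuantumFields.YangMills.Theorems.ToronSmallBallOwnAxisShiftNumerics
import HarnessLib

/-!
# The own-axis sheet shift: the numeric inequalities for the single-holonomy strip window (`QuantileBitPurity` r3)

Support module (`--supports` stmt-QuantumFields-24092, `QuantileBitPurity.HolonomyLevyWindowDeepR`; seat ym-dw-p1 g15).  Pure real-variable
bookkeeping, no lattice object.  With the constants of `ToronSmallBallOwnAxisShiftNumerics` (`η = β^(−19/40)`, `w = β^(−(1/2 − 4a))`,
`σ = β^(−2/5)/4`) the strip `{|polDist − c| ≤ w}` at a centre `c ≥ β^(−2/5)` is off-core with radius `c₀ = c − 2w`, and the floor hypothesis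
`4L²η ≤ c₀/2 − σ` of the window estimate follows from the one extra inequality

★ `ineq_floor_strip`: `4L²η + w ≤ β^(−2/5)/4` for `β ≥ max(32^{1/(3/40 − 2a)}, 8^{1/(1/10 − 4a)})`, `L ≤ β^a`;

`numericsR_of_le` bundles it with `numerics_of_le`.

HONEST FRAMING: elementary real analysis; nothing about lattice gauge theory.  No `sorry`, no new axiom, no new definition.  References: [folklore].
-/

set_option autoImplicit false

noncomputable section

open Real

namespace Summit.QuantumFields.YangMills.Theorems.FemtoTransferGap.OwnAxis

section Ineq

variable {a β : ℝ} {L : ℕ}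

/-- ★ (T2') strip floor: `4L(Lη) + w ≤ β^{−2/5}/4`. [folklore] -/
theorem ineq_floor_strip (ha : 0 < a) (ha' : a ≤ 1 / 400) (hβ1 : 1 ≤ β) (hL : (L : ℝ) ≤ β ^ a)
    (h32 : (32 : ℝ) ^ (1 / (-(2 * a - 3 / 40))) ≤ β) (h8 : (8 : ℝ) ^ (1 / (-(4 * a - 1 / 10))) ≤ β) :
    4 * ((L : ℝ) * (L * β ^ (-(19 / 40 : ℝ)))) + β ^ (-(1 / 2 - 4 * a)) ≤ β ^ (-(2 / 5 : ℝ)) / 4 := by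
  have hβ0 : 0 < β := by linarith
  have hL2 : (L : ℝ) ^ 2 ≤ β ^ ((2 : ℕ) * a) := pow_le_rpow_mul hβ0.le (Nat.cast_nonneg L) hL 2
  have hc0 : 0 < β ^ (-(2 / 5 : ℝ)) := Real.rpow_pos_of_pos hβ0 _
  have hη0 : 0 < β ^ (-(19 / 40 : ℝ)) := Real.rpow_pos_of_pos hβ0 _
  -- the lattice part: `32 L² η ≤ β^{-2/5}`
  have key : 32 * β ^ (2 * a - 3 / 40) ≤ 1 := mul_rpow_le_one_of_le (by norm_num) (by linarith) h32
  have hsplit : β ^ (2 * a - 3 / 40) = β ^ ((2 : ℕ) * a) * β ^ (-(19 / 40 : ℝ)) * (β ^ (-(2 / 5 : ℝ)))⁻¹ := by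
    rw [← Real.rpow_neg hβ0.le, neg_neg, ← Real.rpow_add hβ0, ← Real.rpow_add hβ0]; congr 1; push_cast; ring
  rw [hsplit] at key
  rw [← mul_assoc, mul_inv_le_iff₀ hc0, one_mul] at key
  -- the width part: `8 w ≤ β^{-2/5}`
  have key2 : 8 * β ^ (4 * a - 1 / 10) ≤ 1 := mul_rpow_le_one_of_le (by norm_num) (by linarith) h8
  have hsplit2 : β ^ (4 * a - 1 / 10) = β ^ (-(1 / 2 - 4 * a)) * (β ^ (-(2 / 5 : ℝ)))⁻¹ := by
    rw [← Real.rpow_neg hβ0.le, neg_neg, ← Real.rpow_add hβ0]; congr 1; ring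
  rw [hsplit2] at key2
  rw [← mul_assoc, mul_inv_le_iff₀ hc0, one_mul] at key2
  calc 4 * ((L : ℝ) * (L * β ^ (-(19 / 40 : ℝ)))) + β ^ (-(1 / 2 - 4 * a))
      = 4 * ((L : ℝ) ^ 2 * β ^ (-(19 / 40 : ℝ))) + β ^ (-(1 / 2 - 4 * a)) := by ring
    _ ≤ 4 * (β ^ ((2 : ℕ) * a) * β ^ (-(19 / 40 : ℝ))) + β ^ (-(1 / 2 - 4 * a)) := by gcongr
    _ ≤ β ^ (-(2 / 5 : ℝ)) / 4 := by linarith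

end Ineq

/-- ★ **All numeric hypotheses of the single-holonomy strip window hold for `β ≥ β₀(a)`** (`0 < a ≤ 1/400`): the thirteen conjuncts of
`numerics_of_le` and the strip floor `4L²η + w ≤ β^{−2/5}/4`. [folklore] -/
theorem numericsR_of_le {a : ℝ} (ha : 0 < a) (ha' : a ≤ 1 / 400) :
    ∃ β₀ : ℝ, ∀ β : ℝ, β₀ ≤ β → ∀ L : ℕ, 1 ≤ L → (L : ℝ) ≤ β ^ a →
      (200 ≤ β ∧ 0 < β ^ (-(19 / 40 : ℝ)) ∧ 0 < β ^ (-(1 / 2 - 4 * a)) ∧ 5 * β ^ (-(1 / 2 - 4 * a)) < 6 * β ^ (-(1 / 2 - 4 * a)) ∧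
      0 < β ^ (-(2 / 5 : ℝ)) / 4 ∧ β ^ (-(2 / 5 : ℝ)) / 4 ≤ 1 ∧
      4 * ((L : ℝ) * (L * β ^ (-(19 / 40 : ℝ)))) ≤ β ^ (-(2 / 5 : ℝ)) / 2 - β ^ (-(2 / 5 : ℝ)) / 4 ∧
      1 ≤ ⌈64 * Real.exp 1 * β ^ a⌉₊ ∧
      ((⌈64 * Real.exp 1 * β ^ a⌉₊ : ℕ) : ℝ) * (6 * β ^ (-(1 / 2 - 4 * a))) ≤ β ^ (-(2 / 5 : ℝ)) / 4 / 2 ∧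
      12 * β * (L : ℝ) ^ 4 *
        ((((⌈64 * Real.exp 1 * β ^ a⌉₊ : ℕ) : ℝ) * (6 * β ^ (-(1 / 2 - 4 * a))) * (2 * (L * β ^ (-(19 / 40 : ℝ))) / (β ^ (-(2 / 5 : ℝ)) / 4))) ^ 2 +
          2 * (((⌈64 * Real.exp 1 * β ^ a⌉₊ : ℕ) : ℝ) * (6 * β ^ (-(1 / 2 - 4 * a))) * (2 * (L * β ^ (-(19 / 40 : ℝ))) / (β ^ (-(2 / 5 : ℝ)) / 4))) *
            β ^ (-(19 / 40 : ℝ))) ≤ 1 ∧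
      4 * (L : ℝ) ^ 4 * (((⌈64 * Real.exp 1 * β ^ a⌉₊ : ℕ) : ℝ) * (6 * β ^ (-(1 / 2 - 4 * a))) / (β ^ (-(2 / 5 : ℝ)) / 4)) ≤ 1 / 2 ∧
      4 * (L : ℝ) * Real.exp (-(β * (β ^ (-(19 / 40 : ℝ))) ^ 2 / 2)) * (β ^ (315 * L ^ 3)) ^ (2 * L) ≤ β ^ (-a) / 2 ∧
      32 * Real.exp 1 / ((⌈64 * Real.exp 1 * β ^ a⌉₊ : ℕ) : ℝ) ≤ β ^ (-a) / 2) ∧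
      4 * ((L : ℝ) * (L * β ^ (-(19 / 40 : ℝ)))) + β ^ (-(1 / 2 - 4 * a)) ≤ β ^ (-(2 / 5 : ℝ)) / 4 := by
  obtain ⟨β₀, hβ₀⟩ := numerics_of_le ha ha'
  refine ⟨max β₀ (max ((32 : ℝ) ^ (1 / (-(2 * a - 3 / 40)))) ((8 : ℝ) ^ (1 / (-(4 * a - 1 / 10))))), fun β hβ L hL1 hL => ?_⟩
  simp only [max_le_iff] at hβ
  obtain ⟨h0, h32, h8⟩ := hβ
  have h := hβ₀ β h0 L hL1 hL
  have hβ1 : 1 ≤ β := by linarith [h.1]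
  exact ⟨h, ineq_floor_strip ha ha' hβ1 hL h32 h8⟩

end Summit.QuantumFields.YangMills.Theorems.FemtoTransferGap.OwnAxis

end
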